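import Summits.CriticalPhenomena.CardyFormulaZ2.Theses.CardyQContinuation
import Literature.Probability.Percolation.SmirnovReflection
import Literature.Probability.LatticeModels.CellGridSaddleSymmetry
import Literature.Probability.Percolation.BondPercolationSymmetry
import Literature.Probability.Percolation.LatticeSymmetry

/-!
# Crux `IsingJetsConformal`, stub `stub_mirrorCrossingRatio`: the self-dual FK crossing ratio
# `P_δ` of the complex-conjugate rectangle equals `P_δ` (route `CardyQContinuation`,
# item stmt-CriticalPhenomena-5560)

The registered stub `stub_mirrorCrossingRatio` of the reshaped skeleton of the crux
`IsingJetsConformal` asks for the EXACT lattice mirror symmetry of the route's inline self-dual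
random-cluster crossing ratio: for every conformal rectangle `R`, every mesh `δ > 0` and every
complex `s`,
`P_δ(R*)(s) = P_δ(R)(s)`, where `R* = MarkedDomain.conjugate R` (carrier `{z | z̄ ∈ Ω}`, arcs the
conjugate arcs, `MarkedDomain.conjugate_arc`) and
`P_δ = N_δ / Z_δ`, `Z_δ(s) = Σᶠ_{ω ⊆ E(Ω_δ)} s^(|ω| + 2 k_B(ω))`,
`N_δ(s) = Σᶠ_{ω ⊆ E(Ω_δ)} 𝟙_{C_δ(Ω; A, B)}(ω) s^(|ω| + 2 k_B(ω))`, `k_B(ω)` the number of connected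
components of `(openGraph ω ⊔ wired ((ab)_δ ∪ (cd)_δ)).induce Ω_δ` (Smirnov's discretisation
`meshDomain` / `discreteDomainGraph` / `discreteArc` of `DomainDiscretisation.lean`, crossing event
`discreteCrossing` of `Crossings.lean`).

Proof. The tree already has the transport of the whole discretisation under any **cell symmetry**
`σ` of `ℤ²` compatible with a plane isometry (`CellGridSaddleSymmetry.lean`: `CellSymmetry`,
`image_cell_meshDomain`, `image_cell_discreteArc`, `discreteDomainGraph_adj_cell`), the axis
reflection `CellSymmetry.reflect` (cells `(x₀, x₁) ↦ (x₀, -x₁)`, plane `z ↦ z̄`) being one of them,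
and the relabelling `ω ↦ σ '' ω` of bond configurations (`BondConfig.relabel (sym2Equiv σ)`,
`openGraph_relabel_adj_iff`, `BondPercolationSymmetry.lean`). We add, for any cell symmetry `σ`
with plane action `g`:

* `powerset_edgeSet_discreteDomainGraph_image_plane`: `ω ↦ σ '' ω` maps `𝒫 E(Ω_δ)` onto
  `𝒫 E((gΩ)_δ)` (`σ` is an isomorphism `Ω_δ ≃g (gΩ)_δ`);
* `relabel_mem_discreteCrossing_iff`: `σ '' ω ∈ C_δ(gΩ; gA, gB) ↔ ω ∈ C_δ(Ω; A, B)`;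
* `weight_relabel_cell`: the weight `s^(|ω| + 2 k_B(ω))` is invariant (`|σ '' ω| = |ω|`, and `σ`
  restricts to an isomorphism of the induced wired open graphs,
  `natCard_connectedComponent_induce_relabel`, so the component counts agree);
* hence `crossingRatio_image_plane`: `P_δ(gΩ; gA, gB)(s) = P_δ(Ω; A, B)(s)` for every `δ` and `s`
  (reindex both finsums along the bijection, `finsum_mem_image`), and its specialisation
  `crossingRatio_conjSet` to complex conjugation (`conjSet S = conj '' S`);
* `stub_mirrorCrossingRatio`: the registered statement, by `MarkedDomain.conjugate_carrier` /
  `MarkedDomain.conjugate_arc`.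

Everything is exact (no limit, all `δ`, all `s ∈ ℂ`); no named fact is used.

References: S. Smirnov, *Critical percolation in the plane*, C. R. Acad. Sci. Paris 333 (2001), §2
(discretisation, "by symmetry"); G. Grimmett, *The Random-Cluster Model* (2006), §4.3 (invariance
of random-cluster weights under lattice automorphisms).
-/

namespace Summit.CriticalPhenomena.CardyFormulaZ2.Theorems.CardyQContinuation

open Set
open Literature.Probability.LatticeModels Literature.Probability.Percolation
open Literature.Probability.RandomPlanarGeometry

noncomputable section

namespace MirrorCrossingRatio

/-! ### Relabelling bond configurations along a bijection: edge counts and wired cluster counts -/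

section Relabel

variable {V W : Type*}

/-- Relabelling preserves the number of open edges: `|σ '' ω| = |ω|`. [folklore] -/
theorem ncard_relabel (φ : V ≃ W) (ω : BondConfig V) :
    (BondConfig.relabel (sym2Equiv φ) ω).ncard = ω.ncard :=
  Set.ncard_image_of_injective _ (sym2Equiv φ).injective

/-- **Wired cluster counts in a sub-domain are invariant under relabelling**: the number of
connected components of `(⟨φ '' ω⟩ ⊔ K_{φ B})[φ M]` is that of `(⟨ω⟩ ⊔ K_B)[M]` — the bijection `φ`
restricts to an isomorphism from the wired open graph `(⟨ω⟩ ⊔ K_B)[M]` induced on `M` onto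
`(⟨φ '' ω⟩ ⊔ K_{φ B})[φ M]`. [cite: Grimmett2006, §4.3] -/
theorem natCard_connectedComponent_induce_relabel (φ : V ≃ W) (ω : BondConfig V) (B M : Set V) :
    Nat.card ((openGraph (BondConfig.relabel (sym2Equiv φ) ω) ⊔ wired (φ '' B)).induce
        (φ '' M)).ConnectedComponent =
      Nat.card ((openGraph ω ⊔ wired B).induce M).ConnectedComponent := by
  let ψ : (openGraph ω ⊔ wired B).induce M ≃g
      (openGraph (BondConfig.relabel (sym2Equiv φ) ω) ⊔ wired (φ '' B)).induce (φ '' M) :=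
    { toEquiv := Equiv.image φ M
      map_rel_iff' := fun {a b} ↦ by
        simp only [SimpleGraph.comap_adj, Function.Embedding.coe_subtype, Equiv.image_apply_coe,
          SimpleGraph.sup_adj, wired_adj, openGraph_relabel_adj_iff, φ.injective.mem_set_image,
          φ.injective.ne_iff] }
  exact (Nat.card_congr ψ.connectedComponentEquiv).symm

end Relabel

/-! ### Transport of `𝒫 E(Ω_δ)`, of the crossing event and of the weights under a cell symmetry -/

section Cell

variable (σ : CellSymmetry) (Ω : Set ℂ) (δ : ℝ)

/-- Edges of `Ω_δ` are carried onto edges of `(gΩ)_δ` (a cell symmetry is an isomorphism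
`Ω_δ ≃g (gΩ)_δ` of the discrete domain graphs, `CellSymmetry.discreteDomainGraph_adj_cell`).
[folklore] -/
theorem sym2Equiv_cell_mem_edgeSet_iff (e : Sym2 (Site 2)) :
    sym2Equiv σ.cell e ∈ (discreteDomainGraph (σ.plane '' Ω) δ).edgeSet ↔
      e ∈ (discreteDomainGraph Ω δ).edgeSet := by
  induction e using Sym2.ind with
  | h x y =>
    rw [sym2Equiv_mk, SimpleGraph.mem_edgeSet, SimpleGraph.mem_edgeSet]
    exact σ.discreteDomainGraph_adj_cell

/-- **Configurations are transported**: `𝒫 E((gΩ)_δ)` is the image of `𝒫 E(Ω_δ)` under the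
relabelling `ω ↦ σ '' ω`. [folklore] -/
theorem powerset_edgeSet_discreteDomainGraph_image_plane :
    𝒫 (discreteDomainGraph (σ.plane '' Ω) δ).edgeSet =
      BondConfig.relabel (sym2Equiv σ.cell) '' 𝒫 (discreteDomainGraph Ω δ).edgeSet := by
  ext ω
  simp only [Set.mem_powerset_iff, Set.mem_image]
  constructor
  · intro hω
    refine ⟨BondConfig.relabel (sym2Equiv σ.cell.symm) ω, fun e he => ?_, ?_⟩
    · rw [BondConfig.mem_relabel_iff, sym2Equiv_symm, Equiv.symm_symm] at he
      exact (sym2Equiv_cell_mem_edgeSet_iff σ Ω δ e).1 (hω he)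
    · have h := relabel_symm_relabel σ.cell.symm ω
      rwa [Equiv.symm_symm] at h
  · rintro ⟨ω', hω', rfl⟩ e he
    rw [BondConfig.mem_relabel_iff, sym2Equiv_symm] at he
    have h := (sym2Equiv_cell_mem_edgeSet_iff σ Ω δ (sym2Equiv σ.cell.symm e)).2 (hω' he)
    rwa [← sym2Equiv_symm, Equiv.apply_symm_apply] at h

/-- **The crossing event is transported**: `σ '' ω` crosses `(gΩ; gA, gB)` at mesh `δ` iff `ω`
crosses `(Ω; A, B)` at mesh `δ` (discrete arcs and `Ω_δ` are transported, and `σ` is an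
isomorphism of the graphs `⟨ω⟩ ⊓ Ω_δ` in which the crossing paths live). [cite: Smirnov2001, §2] -/
theorem relabel_mem_discreteCrossing_iff (A B : Set ℂ) (ω : BondConfig (Site 2)) :
    BondConfig.relabel (sym2Equiv σ.cell) ω ∈
        discreteCrossing (σ.plane '' Ω) δ (σ.plane '' A) (σ.plane '' B) ↔
      ω ∈ discreteCrossing Ω δ A B := by
  let φ : openGraph ω ⊓ discreteDomainGraph Ω δ ≃g
      openGraph (BondConfig.relabel (sym2Equiv σ.cell) ω) ⊓ discreteDomainGraph (σ.plane '' Ω) δ :=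
    { toEquiv := σ.cell
      map_rel_iff' := fun {a b} ↦ by
        rw [SimpleGraph.inf_adj, SimpleGraph.inf_adj, openGraph_relabel_adj_iff,
          σ.discreteDomainGraph_adj_cell] }
  rw [mem_discreteCrossing_iff, mem_discreteCrossing_iff, ← σ.image_cell_discreteArc,
    ← σ.image_cell_discreteArc]
  constructor
  · rintro ⟨_, ⟨x, hx, rfl⟩, _, ⟨y, hy, rfl⟩, h⟩
    exact ⟨x, hx, y, hy, (SimpleGraph.Iso.reachable_iff (φ := φ)).1 h⟩
  · rintro ⟨x, hx, y, hy, h⟩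
    exact ⟨σ.cell x, ⟨x, hx, rfl⟩, σ.cell y, ⟨y, hy, rfl⟩,
      (SimpleGraph.Iso.reachable_iff (φ := φ)).2 h⟩

/-- **The self-dual weights are transported**: `s^(|σω| + 2 k_{gB}(σω)) = s^(|ω| + 2 k_B(ω))`, the
clusters being counted in `(gΩ)_δ = σ(Ω_δ)` with the discrete arcs `(gA)_δ ∪ (gB)_δ = σ((A)_δ ∪ (B)_δ)`
wired. [cite: Grimmett2006, §4.3] -/
theorem weight_relabel_cell (A B : Set ℂ) (s : ℂ) (ω : BondConfig (Site 2)) :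
    s ^ ((BondConfig.relabel (sym2Equiv σ.cell) ω).ncard + 2 * Nat.card
        ((openGraph (BondConfig.relabel (sym2Equiv σ.cell) ω) ⊔ wired
          (discreteArc (σ.plane '' Ω) δ (σ.plane '' A) ∪ discreteArc (σ.plane '' Ω) δ (σ.plane '' B))).induce
          (meshDomain (σ.plane '' Ω) δ)).ConnectedComponent) =
      s ^ (ω.ncard + 2 * Nat.card ((openGraph ω ⊔ wired
        (discreteArc Ω δ A ∪ discreteArc Ω δ B)).induce (meshDomain Ω δ)).ConnectedComponent) := by
  rw [← σ.image_cell_discreteArc Ω δ A, ← σ.image_cell_discreteArc Ω δ B, ← Set.image_union,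
    ← σ.image_cell_meshDomain Ω δ, natCard_connectedComponent_induce_relabel, ncard_relabel]

/-- **Covariance of the inline self-dual FK crossing ratio under cell symmetries**: for every cell
symmetry with plane action `g`, every mesh `δ` and every complex `s`,
`P_δ(gΩ; gA, gB)(s) = P_δ(Ω; A, B)(s)` — numerator and denominator are reindexed along the
bijection `ω ↦ σ '' ω : 𝒫 E(Ω_δ) → 𝒫 E((gΩ)_δ)`, under which the crossing event and the weights
correspond. [cite: Smirnov2001, §2] -/
theorem crossingRatio_image_plane (A B : Set ℂ) (s : ℂ) :
    (∑ᶠ ω ∈ 𝒫 (discreteDomainGraph (σ.plane '' Ω) δ).edgeSet,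
        (discreteCrossing (σ.plane '' Ω) δ (σ.plane '' A) (σ.plane '' B)).indicator
          (fun ω ↦ s ^ (ω.ncard + 2 * Nat.card ((openGraph ω ⊔ wired
            (discreteArc (σ.plane '' Ω) δ (σ.plane '' A) ∪
              discreteArc (σ.plane '' Ω) δ (σ.plane '' B))).induce
            (meshDomain (σ.plane '' Ω) δ)).ConnectedComponent)) ω) /
      (∑ᶠ ω ∈ 𝒫 (discreteDomainGraph (σ.plane '' Ω) δ).edgeSet,
        s ^ (ω.ncard + 2 * Nat.card ((openGraph ω ⊔ wired
          (discreteArc (σ.plane '' Ω) δ (σ.plane '' A) ∪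
            discreteArc (σ.plane '' Ω) δ (σ.plane '' B))).induce
          (meshDomain (σ.plane '' Ω) δ)).ConnectedComponent)) =
    (∑ᶠ ω ∈ 𝒫 (discreteDomainGraph Ω δ).edgeSet,
        (discreteCrossing Ω δ A B).indicator
          (fun ω ↦ s ^ (ω.ncard + 2 * Nat.card ((openGraph ω ⊔ wired
            (discreteArc Ω δ A ∪ discreteArc Ω δ B)).induce
            (meshDomain Ω δ)).ConnectedComponent)) ω) /
      (∑ᶠ ω ∈ 𝒫 (discreteDomainGraph Ω δ).edgeSet,
        s ^ (ω.ncard + 2 * Nat.card ((openGraph ω ⊔ wired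
          (discreteArc Ω δ A ∪ discreteArc Ω δ B)).induce (meshDomain Ω δ)).ConnectedComponent)) := by
  rw [powerset_edgeSet_discreteDomainGraph_image_plane,
    finsum_mem_image (BondConfig.relabel (sym2Equiv σ.cell)).injective.injOn,
    finsum_mem_image (BondConfig.relabel (sym2Equiv σ.cell)).injective.injOn]
  congr 1
  · refine finsum_mem_congr rfl fun ω _ ↦ ?_
    by_cases hω : ω ∈ discreteCrossing Ω δ A B
    · rw [Set.indicator_of_mem ((relabel_mem_discreteCrossing_iff σ Ω δ A B ω).2 hω),
        Set.indicator_of_mem hω, weight_relabel_cell]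
    · rw [Set.indicator_of_notMem (mt (relabel_mem_discreteCrossing_iff σ Ω δ A B ω).1 hω),
        Set.indicator_of_notMem hω]
  · exact finsum_mem_congr rfl fun ω _ ↦ weight_relabel_cell σ Ω δ A B s ω

end Cell

/-! ### Complex conjugation -/

/-- The conjugate set `{z | z̄ ∈ S}` is the image of `S` under the plane action `z ↦ z̄` of the
axis reflection `CellSymmetry.reflect`. [folklore] -/
theorem conjSet_eq_image_reflect_plane (S : Set ℂ) :
    conjSet S = CellSymmetry.reflect.plane '' S := by
  rw [conjSet_eq_image, CellSymmetry.image_reflect_plane]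

/-- **Mirror symmetry of the inline self-dual FK crossing ratio**: for all `δ` and all complex `s`,
`P_δ(Ω*; A*, B*)(s) = P_δ(Ω; A, B)(s)` for the complex-conjugate domain and arcs (the case
`σ = CellSymmetry.reflect`, `(x₀, x₁) ↦ (x₀, -x₁)`, of `crossingRatio_image_plane`).
[cite: Smirnov2001, §2] -/
theorem crossingRatio_conjSet (Ω : Set ℂ) (δ : ℝ) (A B : Set ℂ) (s : ℂ) :
    (∑ᶠ ω ∈ 𝒫 (discreteDomainGraph (conjSet Ω) δ).edgeSet,
        (discreteCrossing (conjSet Ω) δ (conjSet A) (conjSet B)).indicator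
          (fun ω ↦ s ^ (ω.ncard + 2 * Nat.card ((openGraph ω ⊔ wired
            (discreteArc (conjSet Ω) δ (conjSet A) ∪ discreteArc (conjSet Ω) δ (conjSet B))).induce
            (meshDomain (conjSet Ω) δ)).ConnectedComponent)) ω) /
      (∑ᶠ ω ∈ 𝒫 (discreteDomainGraph (conjSet Ω) δ).edgeSet,
        s ^ (ω.ncard + 2 * Nat.card ((openGraph ω ⊔ wired
          (discreteArc (conjSet Ω) δ (conjSet A) ∪ discreteArc (conjSet Ω) δ (conjSet B))).induce
          (meshDomain (conjSet Ω) δ)).ConnectedComponent)) =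
    (∑ᶠ ω ∈ 𝒫 (discreteDomainGraph Ω δ).edgeSet,
        (discreteCrossing Ω δ A B).indicator
          (fun ω ↦ s ^ (ω.ncard + 2 * Nat.card ((openGraph ω ⊔ wired
            (discreteArc Ω δ A ∪ discreteArc Ω δ B)).induce
            (meshDomain Ω δ)).ConnectedComponent)) ω) /
      (∑ᶠ ω ∈ 𝒫 (discreteDomainGraph Ω δ).edgeSet,
        s ^ (ω.ncard + 2 * Nat.card ((openGraph ω ⊔ wired
          (discreteArc Ω δ A ∪ discreteArc Ω δ B)).induce (meshDomain Ω δ)).ConnectedComponent)) := by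
  rw [conjSet_eq_image_reflect_plane Ω, conjSet_eq_image_reflect_plane A,
    conjSet_eq_image_reflect_plane B]
  exact crossingRatio_image_plane CellSymmetry.reflect Ω δ A B s

end MirrorCrossingRatio

open MirrorCrossingRatio

/-- **Stub `stub_mirrorCrossingRatio` (mirror symmetry, exact)** of the reshaped skeleton of the crux
`IsingJetsConformal` (stmt-CriticalPhenomena-5560): for every conformal rectangle `R`, every mesh
`δ > 0` and every complex `s`, the inline self-dual FK crossing ratio `P_δ` of the complex-conjugate
rectangle `R* = MarkedDomain.conjugate R` equals that of `R` — Smirnov's discretisation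
(`meshDomain`, `discreteArc`, `discreteCrossing`) and the weights `s^(|ω| + 2 k_B(ω))` are
equivariant under the lattice reflection `(x₀, x₁) ↦ (x₀, -x₁)` realising `z ↦ z̄` on `δℤ²`.
[cite: Smirnov2001, §2] -/
theorem stub_mirrorCrossingRatio :
    (let w : Literature.Probability.RandomPlanarGeometry.ConformalRectangle → ℝ → ℂ → Set (Sym2 (Literature.Probability.LatticeModels.Site 2)) → ℂ := fun R δ s ω ↦ s ^ (ω.ncard + 2 * Nat.card ((Literature.Probability.Percolation.openGraph ω ⊔ Literature.Probability.LatticeModels.wired (Literature.Probability.LatticeModels.discreteArc R.carrier δ (R.arc 0) ∪ Literature.Probability.LatticeModels.discreteArc R.carrier δ (R.arc 2))).induce (Literature.Probability.LatticeModels.meshDomain R.carrier δ)).ConnectedComponent); let P : Literature.Probability.RandomPlanarGeometry.ConformalRectangle → ℝ → ℂ → ℂ := fun R δ s ↦ (∑ᶠ ω ∈ 𝒫 (Literature.Probability.LatticeModels.discreteDomainGraph R.carrier δ).edgeSet, (Literature.Probability.Percolation.discreteCrossing R.carrier δ (R.arc 0) (R.arc 2)).indicator (w R δ s) ω) / (∑ᶠ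 ω ∈ 𝒫 (Literature.Probability.LatticeModels.discreteDomainGraph R.carrier δ).edgeSet, w R δ s ω); ∀ (R : Literature.Probability.RandomPlanarGeometry.ConformalRectangle) (δ : ℝ), 0 < δ → ∀ s : ℂ, P R.conjugate δ s = P R δ s) := by
  dsimp only
  intro R δ _ s
  rw [MarkedDomain.conjugate_arc R 0, MarkedDomain.conjugate_arc R 2]
  exact crossingRatio_conjSet R.carrier δ (R.arc 0) (R.arc 2) s

end

end Summit.CriticalPhenomena.CardyFormulaZ2.Theorems.CardyQContinuation
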